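import Literature.Computability.MetaComplexity.TwoModuliExpSums
import Literature.Analysis.Fourier.DiscreteSummationByParts

set_option linter.dupNamespace false

/-!
# SaturationCriterionA (lens 4, g29; kernel step towards K5 of the (c0) road) — FIBRES OF A LABELLED MAP ARE NON-EMPTY WHEN THE NON-TRIVIAL CHARACTER SUMS ARE SMALL

Blocker `X = AbsorptionDial.NoPerfectPolyOdd` (item 28487); decomp-qadv lens 4, g29.  Generic finite Fourier bookkeeping over the group
`(ℤ/p)^K × ℤ/3` (the value group of the column maps of the (c0) road: `K` residues mod `p` — cross terms, internal quadratic value, labels —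
and the walk datum mod `3`), on top of the tree's `Literature.Computability.MetaComplexity.TwoModuliExpSums` (orthogonality
`ite_eq_eq_sum_stdAddChar`, `ite_eq_eq_sum_stdAddChar_one`; factor bounds `norm_one_add_stdAddChar_mul_stdAddChar_le`, `norm_one_add_stdAddChar_le`;
`sum_bool_fun_prod`, `stdAddChar_sum_ite`).

* `charSum Φ W γ m = Σ_x χ_p(⟨γ, Φ x⟩) χ₃(m·W x)` for ANY maps `Φ : X → (ℤ/p)^K`, `W : X → ℤ/3` on a finite set `X`;
  `card_fibre_mul_eq` — the COUNTING FORMULA `#{x : Φ x = v, W x = a} · 3p^K = Σ_{(γ,m)} χ_p(−⟨γ,v⟩) χ₃(−ma) · charSum Φ W γ m`;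
  ★ `fibre_nonempty_of_charSum_lt` — if `Σ_{(γ,m) ≠ 0} ‖charSum Φ W γ m‖ < |X|` then EVERY fibre `{Φ = v, W = a}` is non-empty
  ((P4) of REFEREE-66v65: «counting formula; `Σ_{χ ≠ 1} |Ŝ(χ)| < 1` ⇒ surjective»).
* the LINEAR case on the cube `X = {0,1}^ι` with a `{1,2}`-weighted count mod `3`: `norm_cubeSum_weighted_eq` (the sum factorises:
  `‖Σ_u χ_p(Σ_{u_i} β_i) χ₃(Σ_{u_i} m_i)‖ = ∏_i ‖1 + χ_p(β_i) χ₃(m_i)‖`), `norm_cubeSum_weighted_le` (`≤ 2^{|ι|} cos(π/(3p))^{#supp β}`),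
  `norm_cubeSum_weighted_le_of_forall` (`≤ (2cos(π/(3p)))^{|ι|}` when every coordinate carries `β_i ≠ 0` or `m_i ≠ 0`);
  ★ `linear_saturation` — `K` linear forms `L` mod `p` on the cube and weights `ww_i ≠ 0` mod `3`: if every non-zero combination
  `Σ_j γ_j L_j` has `≥ w` non-zero coordinates (`w ≤ |ι|`) and `3p^K · cos(π/(3p))^w < 1`, the map `u ↦ (L u, Σ_{u_i} ww_i)` is ONTO
  `(ℤ/p)^K × ℤ/3` — the three `s = 0` character classes of (P4) in one statement (labels, cross terms and the walk datum of a column pool on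
  which the internal quadratic value is itself linear, e.g. a pair-free pool).

Not here: the character class with a non-zero coefficient on a genuinely QUADRATIC coordinate ((P4) `s ≠ 0`: Cauchy–Schwarz along a dispersing
bipartition, and the (P7) cos² law / Bogolyubov–Ruzsa input when no bipartition disperses).
-/

open Finset Complex ZMod
open Literature.Computability.MetaComplexity.TwoModuli

namespace Summit.QuantumAdvantage.QuantumAdvantage.Theorems.SaturationCriterion

/-! ### 1. The counting formula and the non-empty-fibre criterion over `(ℤ/p)^K × ℤ/3` -/

section Criterion

variable {p : ℕ} [NeZero p] {K : ℕ} {X : Type*} [Fintype X]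

/-- the character sum of the labelled map `(Φ, W)` at the dual pair `(γ, m)`: `Σ_x χ_p(Σ_j γ_j (Φ x)_j) · χ₃(m · W x)` -/
noncomputable def charSum (Φ : X → Fin K → ZMod p) (W : X → ZMod 3) (γ : Fin K → ZMod p) (m : ZMod 3) : ℂ :=
  ∑ x, (stdAddChar (∑ j, γ j * Φ x j) : ℂ) * stdAddChar (m * W x)

/-- at the trivial dual pair the character sum is `|X|` -/
theorem charSum_zero (Φ : X → Fin K → ZMod p) (W : X → ZMod 3) : charSum Φ W 0 0 = Fintype.card X := by
  unfold charSum
  simp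

/-- **THE COUNTING FORMULA.**  `#{x : Φ x = v ∧ W x = a} · (3·p^K) = Σ_{γ, m} χ_p(−⟨γ, v⟩) χ₃(−m a) · charSum Φ W γ m`. -/
theorem card_fibre_mul_eq [DecidableEq X] (Φ : X → Fin K → ZMod p) (W : X → ZMod 3) (v : Fin K → ZMod p) (a : ZMod 3) :
    ((univ.filter fun x => Φ x = v ∧ W x = a).card : ℂ) * ((p : ℂ) ^ K * 3)
      = ∑ γm : (Fin K → ZMod p) × ZMod 3,
          (stdAddChar (-∑ j, γm.1 j * v j) : ℂ) * stdAddChar (-(γm.2 * a)) * charSum Φ W γm.1 γm.2 := by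
  classical
  have hpK : ((p : ℂ) ^ K) ≠ 0 := pow_ne_zero _ (by exact_mod_cast NeZero.ne p)
  have h3 : ((3 : ℕ) : ℂ) ≠ 0 := by norm_num
  -- the indicator of the fibre, expanded
  have hind : ∀ x, ((if Φ x = v ∧ W x = a then (1 : ℂ) else 0)) * ((p : ℂ) ^ K * 3)
      = ∑ γm : (Fin K → ZMod p) × ZMod 3,
          (stdAddChar (-∑ j, γm.1 j * v j) : ℂ) * stdAddChar (-(γm.2 * a)) *
            ((stdAddChar (∑ j, γm.1 j * Φ x j) : ℂ) * stdAddChar (γm.2 * W x)) := by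
    intro x
    have h1 : (if Φ x = v ∧ W x = a then (1 : ℂ) else 0) = (if Φ x = v then (1 : ℂ) else 0) * (if W x = a then (1 : ℂ) else 0) := by
      by_cases hv : Φ x = v <;> by_cases ha : W x = a <;> simp [hv, ha]
    have hsplit : ∀ γ : Fin K → ZMod p, (stdAddChar (∑ j, γ j * (Φ x j - v j)) : ℂ)
        = stdAddChar (∑ j, γ j * Φ x j) * stdAddChar (-∑ j, γ j * v j) := by
      intro γ
      rw [← AddChar.map_add_eq_mul, ← sub_eq_add_neg, ← sum_sub_distrib]
      congr 1
      refine sum_congr rfl fun j _ => ?_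
      ring
    rw [h1, ite_eq_eq_sum_stdAddChar (Φ x) v, ite_eq_eq_sum_stdAddChar_one (N := 3) (W x) a, Fintype.sum_prod_type]
    rw [show ∀ (A B : ℂ), ((p : ℂ) ^ K)⁻¹ * A * ((((3 : ℕ) : ℂ))⁻¹ * B) * ((p : ℂ) ^ K * 3) = A * B from fun A B => by
      field_simp
      push_cast
      ring]
    rw [sum_mul_sum]
    refine sum_congr rfl fun γ _ => sum_congr rfl fun m _ => ?_
    rw [hsplit γ]
    ring
  rw [natCast_card_filter, sum_mul]
  simp_rw [hind]
  rw [sum_comm]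
  refine sum_congr rfl fun γm _ => ?_
  rw [charSum, mul_sum]

/-- **NON-EMPTY FIBRES ((P4) of the (c0) road: «counting formula; Σ_{χ≠1}|Ŝ(χ)| < 1 ⇒ surjective»).**  If the non-trivial character sums of the
labelled map are small in total, `Σ_{(γ,m) ≠ (0,0)} ‖charSum Φ W γ m‖ < |X|`, then `(Φ, W) : X → (ℤ/p)^K × ℤ/3` is ONTO. -/
theorem fibre_nonempty_of_charSum_lt (Φ : X → Fin K → ZMod p) (W : X → ZMod 3)
    (h : ∑ γm ∈ (univ : Finset ((Fin K → ZMod p) × ZMod 3)).erase 0, ‖charSum Φ W γm.1 γm.2‖ < Fintype.card X)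
    (v : Fin K → ZMod p) (a : ZMod 3) :
    ∃ x, Φ x = v ∧ W x = a := by
  classical
  by_contra hno
  push Not at hno
  have hcard : (univ.filter fun x => Φ x = v ∧ W x = a).card = 0 := by
    rw [card_eq_zero, filter_eq_empty_iff]
    intro x _ hx
    exact hno x hx.1 hx.2
  have hexp := card_fibre_mul_eq Φ W v a
  rw [hcard, Nat.cast_zero, zero_mul] at hexp
  -- isolate the trivial dual pair
  have h0 : (0 : (Fin K → ZMod p) × ZMod 3) ∈ (univ : Finset ((Fin K → ZMod p) × ZMod 3)) := mem_univ _
  rw [← add_sum_erase _ _ h0] at hexp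
  simp only [Prod.fst_zero, Prod.snd_zero, Pi.zero_apply, zero_mul, sum_const_zero, neg_zero,
    AddChar.map_zero_eq_one, one_mul, charSum_zero] at hexp
  -- `|X| = -Σ_{≠0} …`, take norms
  have heq : (Fintype.card X : ℂ) = -∑ γm ∈ (univ : Finset ((Fin K → ZMod p) × ZMod 3)).erase 0,
      (stdAddChar (-∑ j, γm.1 j * v j) : ℂ) * stdAddChar (-(γm.2 * a)) * charSum Φ W γm.1 γm.2 := by
    linear_combination hexp.symm
  have hle : (Fintype.card X : ℝ) ≤ ∑ γm ∈ (univ : Finset ((Fin K → ZMod p) × ZMod 3)).erase 0, ‖charSum Φ W γm.1 γm.2‖ := by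
    calc (Fintype.card X : ℝ) = ‖(Fintype.card X : ℂ)‖ := by rw [Complex.norm_natCast]
      _ = ‖∑ γm ∈ (univ : Finset ((Fin K → ZMod p) × ZMod 3)).erase 0,
            (stdAddChar (-∑ j, γm.1 j * v j) : ℂ) * stdAddChar (-(γm.2 * a)) * charSum Φ W γm.1 γm.2‖ := by
          rw [heq, norm_neg]
      _ ≤ ∑ γm ∈ (univ : Finset ((Fin K → ZMod p) × ZMod 3)).erase 0,
            ‖(stdAddChar (-∑ j, γm.1 j * v j) : ℂ) * stdAddChar (-(γm.2 * a)) * charSum Φ W γm.1 γm.2‖ := norm_sum_le _ _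
      _ = ∑ γm ∈ (univ : Finset ((Fin K → ZMod p) × ZMod 3)).erase 0, ‖charSum Φ W γm.1 γm.2‖ := by
          refine sum_congr rfl fun γm _ => ?_
          rw [norm_mul, norm_mul, Literature.Analysis.Fourier.norm_stdAddChar, Literature.Analysis.Fourier.norm_stdAddChar, one_mul, one_mul]
  linarith

end Criterion

/-! ### 2. The linear case on the cube with a weighted count mod `3` -/

section Cube

variable {p : ℕ} [NeZero p] {ι : Type*} [Fintype ι] [DecidableEq ι]

/-- **the weighted two-moduli cube sum factorises**: `‖Σ_u χ_p(Σ_{u_i} β_i) χ₃(Σ_{u_i} m_i)‖ = ∏_i ‖1 + χ_p(β_i) χ₃(m_i)‖`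
(per-coordinate twists `m_i`; the tree's `norm_cubeSum_eq` is the case of a common twist) -/
theorem norm_cubeSum_weighted_eq (β : ι → ZMod p) (m : ι → ZMod 3) :
    ‖∑ u : ι → Bool, (stdAddChar (∑ i, if u i then β i else 0) : ℂ) * stdAddChar (∑ i, if u i then m i else 0)‖
      = ∏ i, ‖(1 : ℂ) + stdAddChar (β i) * stdAddChar (m i)‖ := by
  have hterm : ∀ u : ι → Bool, (stdAddChar (∑ i, if u i then β i else 0) : ℂ) * stdAddChar (∑ i, if u i then m i else 0)
      = ∏ i, (fun (i : ι) (b : Bool) => if b then (stdAddChar (β i) : ℂ) * stdAddChar (m i) else 1) i (u i) := by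
    intro u
    rw [stdAddChar_sum_ite, stdAddChar_sum_ite, ← prod_mul_distrib]
    refine prod_congr rfl fun i _ => ?_
    cases u i <;> simp
  simp_rw [hterm]
  rw [sum_bool_fun_prod (fun (i : ι) (b : Bool) => if b then (stdAddChar (β i) : ℂ) * stdAddChar (m i) else 1),
    Complex.norm_prod]
  refine prod_congr rfl fun i _ => ?_
  simp

/-- **bound by the support of the mod-`p` part**: `≤ 2^{|ι|} · cos(π/(3p))^{#supp β}` (`gcd(p,3) = 1`). -/
theorem norm_cubeSum_weighted_le (hp3 : p.Coprime 3) (β : ι → ZMod p) (m : ι → ZMod 3) :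
    ‖∑ u : ι → Bool, (stdAddChar (∑ i, if u i then β i else 0) : ℂ) * stdAddChar (∑ i, if u i then m i else 0)‖
      ≤ 2 ^ Fintype.card ι * Real.cos (Real.pi / (p * 3)) ^ (univ.filter fun i => β i ≠ 0).card := by
  rw [norm_cubeSum_weighted_eq]
  have hfac : ∀ i, ‖(1 : ℂ) + stdAddChar (β i) * stdAddChar (m i)‖
      ≤ 2 * (if β i ≠ 0 then Real.cos (Real.pi / (p * 3)) else 1) := by
    intro i
    split_ifs with hi
    · exact norm_one_add_stdAddChar_mul_stdAddChar_le hp3 hi (m i)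
    · calc ‖(1 : ℂ) + stdAddChar (β i) * stdAddChar (m i)‖
          ≤ ‖(1 : ℂ)‖ + ‖(stdAddChar (β i) : ℂ) * stdAddChar (m i)‖ := norm_add_le _ _
        _ = 2 * 1 := by rw [norm_mul, Literature.Analysis.Fourier.norm_stdAddChar, Literature.Analysis.Fourier.norm_stdAddChar]; norm_num
  calc ∏ i, ‖(1 : ℂ) + stdAddChar (β i) * stdAddChar (m i)‖
      ≤ ∏ i, 2 * (if β i ≠ 0 then Real.cos (Real.pi / (p * 3)) else (1 : ℝ)) :=
        prod_le_prod (fun i _ => norm_nonneg _) fun i _ => hfac i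
    _ = 2 ^ Fintype.card ι * Real.cos (Real.pi / (p * 3)) ^ (univ.filter fun i => β i ≠ 0).card := by
        rw [prod_mul_distrib, prod_const, card_univ, prod_ite, prod_const_one, mul_one, prod_const]

/-- **bound when every coordinate is twisted**: if each `i` has `β_i ≠ 0` or `m_i ≠ 0` then `≤ (2cos(π/(3p)))^{|ι|}`
(a coordinate with `β_i = 0`, `m_i ≠ 0` contributes `‖1 + χ₃(m_i)‖ ≤ 2cos(π/3) ≤ 2cos(π/(3p))`). -/
theorem norm_cubeSum_weighted_le_of_forall (hp3 : p.Coprime 3) (β : ι → ZMod p) (m : ι → ZMod 3)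
    (hall : ∀ i, β i ≠ 0 ∨ m i ≠ 0) :
    ‖∑ u : ι → Bool, (stdAddChar (∑ i, if u i then β i else 0) : ℂ) * stdAddChar (∑ i, if u i then m i else 0)‖
      ≤ (2 * Real.cos (Real.pi / (p * 3))) ^ Fintype.card ι := by
  rw [norm_cubeSum_weighted_eq]
  have hp1 : (1 : ℝ) ≤ p := by exact_mod_cast NeZero.one_le
  have hmono : Real.cos (Real.pi / 3) ≤ Real.cos (Real.pi / (p * 3)) := by
    apply Real.cos_le_cos_of_nonneg_of_le_pi
    · positivity
    · calc Real.pi / 3 ≤ Real.pi / 1 := by gcongr; norm_num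
        _ = Real.pi := div_one _
    · gcongr
      linarith
  have hfac : ∀ i, ‖(1 : ℂ) + stdAddChar (β i) * stdAddChar (m i)‖ ≤ 2 * Real.cos (Real.pi / (p * 3)) := by
    intro i
    rcases hall i with hβ | hm
    · exact norm_one_add_stdAddChar_mul_stdAddChar_le hp3 hβ (m i)
    · by_cases hβ : β i ≠ 0
      · exact norm_one_add_stdAddChar_mul_stdAddChar_le hp3 hβ (m i)
      · push Not at hβ
        rw [hβ, AddChar.map_zero_eq_one, one_mul]
        calc ‖(1 : ℂ) + stdAddChar (m i)‖ ≤ 2 * Real.cos (Real.pi / 3) := by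
              have := norm_one_add_stdAddChar_le (p := 3) hm
              simpa using this
          _ ≤ 2 * Real.cos (Real.pi / (p * 3)) := by linarith
  calc ∏ i, ‖(1 : ℂ) + stdAddChar (β i) * stdAddChar (m i)‖
      ≤ ∏ _i : ι, 2 * Real.cos (Real.pi / (p * 3)) := prod_le_prod (fun i _ => norm_nonneg _) fun i _ => hfac i
    _ = (2 * Real.cos (Real.pi / (p * 3))) ^ Fintype.card ι := by rw [prod_const, card_univ]

/-- **LINEAR SATURATION (the three `s = 0` character classes of (P4) in one statement).**  `K` linear forms `L_j` mod `p` on the cube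
`{0,1}^ι` and weights `ww_i ≠ 0` mod `3`.  If every non-zero combination `Σ_j γ_j L_j` has at least `w ≤ |ι|` non-zero coordinates and
`3·p^K·cos(π/(3p))^w < 1`, then `u ↦ ((Σ_{u_i} L_{j,i})_j, Σ_{u_i} ww_i)` is ONTO `(ℤ/p)^K × ℤ/3`. -/
theorem linear_saturation (hp3 : p.Coprime 3) {K : ℕ} (L : Fin K → ι → ZMod p) (ww : ι → ZMod 3) (hww : ∀ i, ww i ≠ 0)
    (w : ℕ) (hwι : w ≤ Fintype.card ι)
    (hfree : ∀ γ : Fin K → ZMod p, γ ≠ 0 → w ≤ (univ.filter fun i => (∑ j, γ j * L j i) ≠ 0).card)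
    (hsmall : (3 * (p : ℝ) ^ K) * Real.cos (Real.pi / (p * 3)) ^ w < 1)
    (v : Fin K → ZMod p) (a : ZMod 3) :
    ∃ u : ι → Bool, (fun j => ∑ i, if u i then L j i else 0) = v ∧ (∑ i, if u i then ww i else 0) = a := by
  classical
  refine fibre_nonempty_of_charSum_lt (fun (u : ι → Bool) (j : Fin K) => ∑ i, if u i then L j i else 0)
    (fun u => ∑ i, if u i then ww i else 0) ?_ v a
  -- each non-trivial character sum is a weighted cube sum of the combined form `β(γ) = Σ_j γ_j L_j`
  have hcos0 : 0 ≤ Real.cos (Real.pi / (p * 3)) := by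
    have hp1 : (1 : ℝ) ≤ p := by exact_mod_cast NeZero.one_le
    apply Real.cos_nonneg_of_neg_pi_div_two_le_of_le
    · have : 0 ≤ Real.pi / (p * 3) := by positivity
      linarith [Real.pi_pos]
    · exact div_le_div_of_nonneg_left Real.pi_pos.le (by norm_num) (by nlinarith)
  have hcos1 : Real.cos (Real.pi / (p * 3)) ≤ 1 := Real.cos_le_one _
  have hS : ∀ γm : (Fin K → ZMod p) × ZMod 3, γm ≠ 0 →
      ‖charSum (fun (u : ι → Bool) (j : Fin K) => ∑ i, if u i then L j i else 0) (fun u => ∑ i, if u i then ww i else 0) γm.1 γm.2‖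
        ≤ 2 ^ Fintype.card ι * Real.cos (Real.pi / (p * 3)) ^ w := by
    intro γm hγm
    have hrw : charSum (fun (u : ι → Bool) (j : Fin K) => ∑ i, if u i then L j i else 0) (fun u => ∑ i, if u i then ww i else 0) γm.1 γm.2
        = ∑ u : ι → Bool, (stdAddChar (∑ i, if u i then (∑ j, γm.1 j * L j i) else 0) : ℂ) *
            stdAddChar (∑ i, if u i then γm.2 * ww i else 0) := by
      unfold charSum
      refine sum_congr rfl fun u _ => ?_
      rw [sum_mul_linForms_eq γm.1 L u, mul_sum]
      congr 2
      refine sum_congr rfl fun i _ => ?_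
      cases u i <;> simp
    rw [hrw]
    by_cases hγ : γm.1 = 0
    · -- `γ = 0`, `m ≠ 0`: every coordinate is twisted
      have hm : γm.2 ≠ 0 := by
        intro hm; apply hγm; ext <;> simp [hγ, hm]
      calc ‖∑ u : ι → Bool, (stdAddChar (∑ i, if u i then (∑ j, γm.1 j * L j i) else 0) : ℂ) *
              stdAddChar (∑ i, if u i then γm.2 * ww i else 0)‖
          ≤ (2 * Real.cos (Real.pi / (p * 3))) ^ Fintype.card ι :=
            norm_cubeSum_weighted_le_of_forall hp3 _ _ fun i => Or.inr (mul_ne_zero hm (hww i))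
        _ = 2 ^ Fintype.card ι * Real.cos (Real.pi / (p * 3)) ^ Fintype.card ι := by rw [mul_pow]
        _ ≤ 2 ^ Fintype.card ι * Real.cos (Real.pi / (p * 3)) ^ w :=
            mul_le_mul_of_nonneg_left (pow_le_pow_of_le_one hcos0 hcos1 hwι) (by positivity)
    · -- `γ ≠ 0`: the combined form has `≥ w` non-zero coordinates
      calc ‖∑ u : ι → Bool, (stdAddChar (∑ i, if u i then (∑ j, γm.1 j * L j i) else 0) : ℂ) *
              stdAddChar (∑ i, if u i then γm.2 * ww i else 0)‖
          ≤ 2 ^ Fintype.card ι * Real.cos (Real.pi / (p * 3)) ^ (univ.filter fun i => (∑ j, γm.1 j * L j i) ≠ 0).card :=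
            norm_cubeSum_weighted_le hp3 _ _
        _ ≤ 2 ^ Fintype.card ι * Real.cos (Real.pi / (p * 3)) ^ w :=
            mul_le_mul_of_nonneg_left (pow_le_pow_of_le_one hcos0 hcos1 (hfree γm.1 hγ)) (by positivity)
  -- sum the bounds over the `3p^K − 1` non-trivial dual pairs
  have hcardG : ((univ : Finset ((Fin K → ZMod p) × ZMod 3)).erase 0).card = p ^ K * 3 - 1 := by
    rw [card_erase_of_mem (mem_univ _), card_univ, Fintype.card_prod, Fintype.card_fun, ZMod.card, ZMod.card, Fintype.card_fin]
  have hX : (Fintype.card (ι → Bool) : ℝ) = 2 ^ Fintype.card ι := by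
    rw [Fintype.card_fun, Fintype.card_bool]; push_cast; ring
  calc ∑ γm ∈ (univ : Finset ((Fin K → ZMod p) × ZMod 3)).erase 0,
        ‖charSum (fun (u : ι → Bool) (j : Fin K) => ∑ i, if u i then L j i else 0) (fun u => ∑ i, if u i then ww i else 0) γm.1 γm.2‖
      ≤ ∑ γm ∈ (univ : Finset ((Fin K → ZMod p) × ZMod 3)).erase 0, 2 ^ Fintype.card ι * Real.cos (Real.pi / (p * 3)) ^ w :=
        sum_le_sum fun γm hγm => hS γm (ne_of_mem_erase hγm)
    _ = ((p ^ K * 3 - 1 : ℕ) : ℝ) * (2 ^ Fintype.card ι * Real.cos (Real.pi / (p * 3)) ^ w) := by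
        rw [sum_const, hcardG, nsmul_eq_mul]
    _ < (Fintype.card (ι → Bool) : ℝ) := by
        rw [hX]
        have h1 : ((p ^ K * 3 - 1 : ℕ) : ℝ) ≤ 3 * (p : ℝ) ^ K := by
          have : (p ^ K * 3 - 1 : ℕ) ≤ p ^ K * 3 := Nat.sub_le _ _
          calc ((p ^ K * 3 - 1 : ℕ) : ℝ) ≤ ((p ^ K * 3 : ℕ) : ℝ) := by exact_mod_cast this
            _ = 3 * (p : ℝ) ^ K := by push_cast; ring
        have h2 : 0 ≤ Real.cos (Real.pi / (p * 3)) ^ w := pow_nonneg hcos0 _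
        have h2p : (0 : ℝ) < 2 ^ Fintype.card ι := by positivity
        calc ((p ^ K * 3 - 1 : ℕ) : ℝ) * (2 ^ Fintype.card ι * Real.cos (Real.pi / (p * 3)) ^ w)
            ≤ 3 * (p : ℝ) ^ K * (2 ^ Fintype.card ι * Real.cos (Real.pi / (p * 3)) ^ w) := by gcongr
          _ = 2 ^ Fintype.card ι * ((3 * (p : ℝ) ^ K) * Real.cos (Real.pi / (p * 3)) ^ w) := by ring
          _ < 2 ^ Fintype.card ι * 1 := by gcongr
          _ = 2 ^ Fintype.card ι := mul_one _

end Cube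

end Summit.QuantumAdvantage.QuantumAdvantage.Theorems.SaturationCriterion
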